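import Summits.AtomisticToContinuum.HydrodynamicLimit.Theorems.InformationPercolationEnginePercolationClosesChaosForecastStatements
import Summits.AtomisticToContinuum.HydrodynamicLimit.Theorems.InformationPercolationEnginePercolationClosesChaosDockingTriples
import HarnessLib

/-!
# Docking S7 of the line `equilibrium-forecast-chain-rule` (crux `InformationPercolationEngine.PercolationClosesChaos`,
stmt-AtomisticToContinuum-15178) — piece C: regrouping the cross-ratio defect of a step by owner

Support file (`--supports stmt-AtomisticToContinuum-15178`) of the registered stub `stub_docking` (worker S7 of lead c2).
After the per-collision replacement (piece B) the kinetic main term of a step leaves the collision-weighted cross-ratio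
defect `G_k = Σ_q Σ_{q'} collPair 1 (q,q') |relDefect Ψ (q,q')|` over ORDERED cell pairs, while the line's increment
`badWeight Ψ η T = min(ownedCount, T) 𝟙{η < unitDefect}` is indexed by OWNED units (`cellMin` of the two start cells). Here:
`cellLT` is a strict total order (`cellLT_asymm`, `cellLT_total`), so `cellMin` is symmetric (`cellMin_comm`) and every
ordered cell pair has exactly one owner (`sum_owner_indicator_eq`); `|relDefect Ψ| ≤ 2CΨ` (`abs_relDefect_le`, from
`abs_fluxAvg_le`, `abs_pairPair_le`, `hardSphereKernel ≥ 0`, `x / 0 = 0`); `ownedCount u · unitDefect u` is the sum of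
`|relDefect|` over the triples owned by `u` (`ownedCount_mul_unitDefect_eq`), whence `G_k = Σ_u ownedCount u · unitDefect u`
(`sum_collPair_mul_abs_relDefect_eq`) and the registered helper `sum_collPair_mul_abs_relDefect_le`:
`G_k ≤ Σ_u [η₁ ownedCount u + 2CΨ (badWeight Ψ η₁ T₁ u + 2 rowCount u 𝟙{T₁/2 < rowCount u})]` (good units pay `η₁` per owned
collision, bad units `2CΨ`, and owned collisions beyond the truncation are row collisions above `T₁/2`, piece C1).
-/

noncomputable section

open MeasureTheory Set Filter Topology
open scoped ENNReal BigOperators Classical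
open Literature.Analysis.FluidPDE Literature.MathematicalPhysics.KineticTheory
open Literature.MathematicalPhysics.KineticTheory.VelocityBlindPlacement

namespace Summit.AtomisticToContinuum.HydrodynamicLimit.Theorems.EquilibriumForecastLine

/-! ## The lexicographic order on cells -/

/-- `cellLT` is asymmetric. [folklore] -/
theorem cellLT_asymm {p q : Cell} (h : cellLT p q) : ¬ cellLT q p := by
  unfold cellLT at h ⊢; omega

/-- `cellLT` is total on distinct cells (they differ in one of the three coordinates). [folklore] -/
theorem cellLT_total {p q : Cell} (h : p ≠ q) : cellLT p q ∨ cellLT q p := by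
  have h' : p 0 ≠ q 0 ∨ p 1 ≠ q 1 ∨ p 2 ≠ q 2 := by
    by_contra h'
    simp only [not_or, ne_eq, not_not] at h'
    exact h (funext fun m => by fin_cases m <;> simp [h'.1, h'.2.1, h'.2.2])
  unfold cellLT; omega

/-- `cellMin p p = p`. [folklore] -/
theorem cellMin_self (p : Cell) : cellMin p p = p := by unfold cellMin; split_ifs <;> rfl

/-- **The owner is symmetric**: `cellMin p q = cellMin q p`. [folklore] -/
theorem cellMin_comm (p q : Cell) : cellMin p q = cellMin q p := by
  by_cases hpq : p = q
  · rw [hpq]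
  unfold cellMin
  rcases cellLT_total hpq with h | h
  · rw [if_neg (cellLT_asymm h), if_pos h]
  · rw [if_pos h, if_neg (cellLT_asymm h)]

/-- **Every ordered cell pair has exactly one owner.** For cells `q, q'` in a finite set `B` and any `u`, summing over
`x ∈ B` the owner-`u` bracket of `unitDefect` (diagonal term at `x = u`; the two off-diagonal terms `(u, x)`, `(x, u)` when
`u = cellMin u x`) against the indicator of the pair `(q, q')` gives the indicator of `cellMin q q' = u`. [folklore] -/
theorem sum_owner_indicator_eq {B : Finset Cell} {q q' : Cell} (hq : q ∈ B) (hq' : q' ∈ B) (u : Cell) (f : ℝ) :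
    ∑ x ∈ B, (if x = u then (if q = u ∧ q' = u then f else 0)
      else if u = cellMin u x then ((if q = u ∧ q' = x then f else 0) + (if q = x ∧ q' = u then f else 0)) else 0) =
      if cellMin q q' = u then f else 0 := by
  -- split off the diagonal term
  have hsplit : ∀ x ∈ B, (if x = u then (if q = u ∧ q' = u then f else 0)
      else if u = cellMin u x then ((if q = u ∧ q' = x then f else 0) + (if q = x ∧ q' = u then f else 0)) else 0) =
      (if x = u then (if q = u ∧ q' = u then f else 0) else 0) +
        ((if x ≠ u ∧ u = cellMin u x ∧ q = u ∧ q' = x then f else 0) +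
          (if x ≠ u ∧ u = cellMin u x ∧ q = x ∧ q' = u then f else 0)) := by
    intro x _
    by_cases hxu : x = u
    · simp [hxu]
    · by_cases hm : u = cellMin u x
      · simp [hxu, ← hm]
      · simp [hxu, hm]
  rw [Finset.sum_congr rfl hsplit, Finset.sum_add_distrib, Finset.sum_add_distrib]
  -- evaluate the three sums
  have h1 : ∑ x ∈ B, (if x = u then (if q = u ∧ q' = u then f else 0) else 0) = if q = u ∧ q' = u then f else 0 := by
    rw [Finset.sum_ite_eq' B u]
    by_cases hu : u ∈ B
    · rw [if_pos hu]
    · rw [if_neg hu, if_neg]; rintro ⟨rfl, -⟩; exact hu hq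
  have h2 : ∑ x ∈ B, (if x ≠ u ∧ u = cellMin u x ∧ q = u ∧ q' = x then f else 0) =
      if q' ≠ u ∧ u = cellMin u q' ∧ q = u then f else 0 := by
    have : ∀ x ∈ B, (if x ≠ u ∧ u = cellMin u x ∧ q = u ∧ q' = x then f else 0) =
        if q' = x then (if q' ≠ u ∧ u = cellMin u q' ∧ q = u then f else 0) else 0 := by
      intro x _
      by_cases hx : q' = x
      · subst hx; simp [and_assoc, and_comm]
      · rw [if_neg hx, if_neg]; rintro ⟨-, -, -, h⟩; exact hx h
    rw [Finset.sum_congr rfl this, Finset.sum_ite_eq B q', if_pos hq']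
  have h3 : ∑ x ∈ B, (if x ≠ u ∧ u = cellMin u x ∧ q = x ∧ q' = u then f else 0) =
      if q ≠ u ∧ u = cellMin u q ∧ q' = u then f else 0 := by
    have : ∀ x ∈ B, (if x ≠ u ∧ u = cellMin u x ∧ q = x ∧ q' = u then f else 0) =
        if q = x then (if q ≠ u ∧ u = cellMin u q ∧ q' = u then f else 0) else 0 := by
      intro x _
      by_cases hx : q = x
      · subst hx; simp [and_assoc, and_comm]
      · rw [if_neg hx, if_neg]; rintro ⟨-, -, h, -⟩; exact hx h
    rw [Finset.sum_congr rfl this, Finset.sum_ite_eq B q, if_pos hq]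
  rw [h1, h2, h3]
  -- case analysis on the ordered pair
  by_cases hqq : q = q'
  · subst hqq
    rw [cellMin_self]
    by_cases hqu : q = u
    · subst hqu; simp
    · simp [hqu]
  · by_cases hqu : q = u
    · subst hqu
      have hq'u : q' ≠ q := fun h => hqq h.symm
      simp only [hq'u, and_false, if_false, ne_eq, not_false_eq_true, true_and, and_true, zero_add, add_zero,
        not_true_eq_false]
      simp_rw [@eq_comm _ q (cellMin q q')]
    · by_cases hq'u : q' = u
      · subst hq'u
        simp only [hqu, if_false, ne_eq, not_false_eq_true, true_and, and_true, zero_add, not_true_eq_false,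
          and_false]
        rw [cellMin_comm q q']
        simp_rw [@eq_comm _ q' (cellMin q' q)]
      · have hne : cellMin q q' ≠ u := by rcases cellMin_mem_pair q q' with h | h <;> rw [h] <;> assumption
        simp [hqu, hq'u, hne]

/-! ## The relative defect is bounded -/

/-- **`|fluxAvg Ψ| ≤ CΨ · fluxAvg 1`** for a continuous mark bounded by `CΨ` (`hardSphereKernel ≥ 0`). [folklore] -/
theorem abs_fluxAvg_le {Ψ : V3 × V3 × V3 → ℝ} (hΨc : Continuous Ψ) {CΨ : ℝ} (hΨ : ∀ p, |Ψ p| ≤ CΨ) (v w : V3) :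
    |fluxAvg Ψ v w| ≤ CΨ * fluxAvg (fun _ => 1) v w := by
  unfold fluxAvg
  have hk : Continuous fun ω : Metric.sphere (0 : V3) 1 => hardSphereKernel (w, v) ω := by
    unfold hardSphereKernel; fun_prop
  have hf : Continuous fun ω : Metric.sphere (0 : V3) 1 => Ψ ((ω : V3), v, w) * hardSphereKernel (w, v) ω :=
    (hΨc.comp (by fun_prop)).mul hk
  have hint := integrable_sphereMeasure_of_continuous_V3 hf
  have hintC := integrable_sphereMeasure_of_continuous_V3 (continuous_const.mul hk (f := fun _ => CΨ))
  calc |∫ ω : Metric.sphere (0 : V3) 1, Ψ ((ω : V3), v, w) * hardSphereKernel (w, v) ω ∂sphereMeasure|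
      ≤ ∫ ω : Metric.sphere (0 : V3) 1, |Ψ ((ω : V3), v, w) * hardSphereKernel (w, v) ω| ∂sphereMeasure :=
        abs_integral_le_integral_abs
    _ ≤ ∫ ω : Metric.sphere (0 : V3) 1, CΨ * hardSphereKernel (w, v) ω ∂sphereMeasure := by
        refine integral_mono hint.abs hintC fun ω => ?_
        have hk0 := (hardSphereKernel_nonneg_le v w ω).1
        dsimp only
        rw [abs_mul, abs_of_nonneg hk0]
        exact mul_le_mul_of_nonneg_right (hΨ _) hk0
    _ = CΨ * ∫ ω : Metric.sphere (0 : V3) 1, (fun _ : V3 × V3 × V3 => (1 : ℝ)) ((ω : V3), v, w) *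
          hardSphereKernel (w, v) ω ∂sphereMeasure := by
        rw [← integral_const_mul]
        simp only [one_mul]

/-- **`|pairPair Ψ| ≤ CΨ · pairPair 1`** for a continuous mark bounded by `CΨ`. [folklore] -/
theorem abs_pairPair_le {σ : ℝ} {N : ℕ} (Φ : Flow σ N) {Ψ : V3 × V3 × V3 → ℝ} (hΨc : Continuous Ψ) {CΨ : ℝ}
    (hΨ : ∀ p, |Ψ p| ≤ CΨ) (c : ℝ) (k : ℕ) (q q' : Cell) (z : Phase N) :
    |pairPair Ψ c σ N Φ k q q' z| ≤ CΨ * pairPair (fun _ => 1) c σ N Φ k q q' z := by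
  unfold pairPair
  have h0 : 0 ≤ (cellCount c σ N ^ 2)⁻¹ := inv_nonneg.2 (sq_nonneg _)
  rw [abs_mul, abs_of_nonneg h0, mul_left_comm]
  refine mul_le_mul_of_nonneg_left ?_ h0
  rw [Finset.mul_sum]
  refine (Finset.abs_sum_le_sum_abs _ _).trans (Finset.sum_le_sum fun i _ => ?_)
  rw [Finset.mul_sum]
  refine (Finset.abs_sum_le_sum_abs _ _).trans (Finset.sum_le_sum fun j _ => ?_)
  split_ifs
  · exact abs_fluxAvg_le hΨc hΨ _ _
  · rw [abs_zero, mul_zero]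

/-- `fluxAvg 1 ≥ 0` (`hardSphereKernel ≥ 0`). [folklore] -/
theorem fluxAvg_one_nonneg (v w : V3) : 0 ≤ fluxAvg (fun _ => 1) v w := by
  unfold fluxAvg
  refine integral_nonneg fun ω => ?_
  have h := (hardSphereKernel_nonneg_le v w ω).1
  simpa only [Pi.zero_apply, one_mul] using h

/-- `pairPair 1 ≥ 0`. [folklore] -/
theorem pairPair_one_nonneg {σ : ℝ} {N : ℕ} (Φ : Flow σ N) (c : ℝ) (k : ℕ) (q q' : Cell) (z : Phase N) :
    0 ≤ pairPair (fun _ => 1) c σ N Φ k q q' z := by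
  unfold pairPair
  refine mul_nonneg (inv_nonneg.2 (sq_nonneg _)) (Finset.sum_nonneg fun i _ => Finset.sum_nonneg fun j _ => ?_)
  split_ifs
  · exact fluxAvg_one_nonneg _ _
  · exact le_rfl

/-- `|a / b| ≤ C` from `|a| ≤ C b`, `b ≥ 0`, `C ≥ 0` (Lean's `a / 0 = 0`). [folklore] -/
theorem abs_div_le_of_abs_le_mul {a b C : ℝ} (hb : 0 ≤ b) (hC : 0 ≤ C) (h : |a| ≤ C * b) : |a / b| ≤ C := by
  rcases hb.eq_or_lt with h0 | hpos
  · rw [← h0, div_zero, abs_zero]; exact hC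
  · rwa [abs_div, abs_of_pos hpos, div_le_iff₀ hpos]

/-- **`|relDefect Ψ| ≤ 2 CΨ`** on the good set (`|collPair Ψ| ≤ CΨ collPair 1`, `|pairPair Ψ| ≤ CΨ pairPair 1`, and Lean's
`x / 0 = 0`). [folklore] -/
theorem abs_relDefect_le {σ : ℝ} {N : ℕ} (Φ : Flow σ N) {z : Phase N} (hz : z ∈ Φ.good) {Ψ : V3 × V3 × V3 → ℝ}
    (hΨc : Continuous Ψ) {CΨ : ℝ} (hΨ : ∀ p, |Ψ p| ≤ CΨ) {c : ℝ} (hc : 0 < c) (hσ : 0 < σ) (k : ℕ) (q q' : Cell) :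
    |relDefect Ψ c σ N Φ k q q' z| ≤ 2 * CΨ := by
  have hCΨ : 0 ≤ CΨ := (abs_nonneg _).trans (hΨ 0)
  have h1 := abs_div_le_of_abs_le_mul (collPair_one_nonneg hc.le hσ Φ k q q' z) hCΨ (abs_collPair_le Φ hz hΨ hc hσ k q q')
  have h2 := abs_div_le_of_abs_le_mul (pairPair_one_nonneg Φ c k q q' z) hCΨ (abs_pairPair_le Φ hΨc hΨ c k q q' z)
  unfold relDefect
  calc _ ≤ |collPair Ψ c σ N Φ k q q' z / collPair (fun _ => 1) c σ N Φ k q q' z| +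
        |pairPair Ψ c σ N Φ k q q' z / pairPair (fun _ => 1) c σ N Φ k q q' z| := abs_sub _ _
    _ ≤ CΨ + CΨ := add_le_add h1 h2
    _ = 2 * CΨ := by ring

/-! ## Regrouping by owner -/

section Owner

variable {σ : ℝ} {N : ℕ} (Φ : Flow σ N) {z : Phase N}

/-- A weighted `collPair 1`: `collPair 1 (a, b) · g a b = (n̄c)⁻¹ Σ_{triples with start cells (a, b)} g (start cells)`.
[folklore] -/
theorem collPair_one_mul_eq (hz : z ∈ Φ.good) (c : ℝ) (k : ℕ) (a b : Cell) (g : Cell → Cell → ℝ) :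
    collPair (fun _ => 1) c σ N Φ k a b z * g a b = (cellCount c σ N * c)⁻¹ *
      ∑ e ∈ collTriples Φ (stepWindow c σ N k) z,
        (if startCell c σ N Φ k z e.2.1 = a ∧ startCell c σ N Φ k z e.2.2 = b then
          g (startCell c σ N Φ k z e.2.1) (startCell c σ N Φ k z e.2.2) else 0) := by
  rw [collPair_eq_sum Φ hz, mul_assoc, Finset.sum_mul]
  congr 1
  refine Finset.sum_congr rfl fun e _ => ?_
  split_ifs with h
  · rw [h.1, h.2, one_mul]
  · rw [zero_mul]

/-- **Owned weight times unit defect, as a sum over the owned triples**: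
`ownedCount u · unitDefect Ψ u = (n̄c)⁻¹ Σ_{triples of the step owned by u} |relDefect Ψ (start cells)|`. [folklore] -/
theorem ownedCount_mul_unitDefect_eq (hz : z ∈ Φ.good) (Ψ : V3 × V3 × V3 → ℝ) {c : ℝ} (hc : 0 < c) (hσ : 0 < σ)
    (k : ℕ) (u : Cell) :
    ownedCount c σ N Φ k u z * unitDefect Ψ c σ N Φ k u z = (cellCount c σ N * c)⁻¹ *
      ∑ e ∈ collTriples Φ (stepWindow c σ N k) z,
        (if cellMin (startCell c σ N Φ k z e.2.1) (startCell c σ N Φ k z e.2.2) = u then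
          |relDefect Ψ c σ N Φ k (startCell c σ N Φ k z e.2.1) (startCell c σ N Φ k z e.2.2) z| else 0) := by
  have hh : 0 < c * meanFreePath σ N := mul_pos hc (meanFreePath_pos hσ N)
  have hpos : 0 < cellCount c σ N * c := mul_pos (cellCount_pos hc hσ N) hc
  -- the `tsum` of `unitDefect` as a sum over the triples
  have hW : (∑' q' : Cell,
      (if q' = u then collPair (fun _ => 1) c σ N Φ k u u z * |relDefect Ψ c σ N Φ k u u z|
        else if u = cellMin u q' then
          collPair (fun _ => 1) c σ N Φ k u q' z * |relDefect Ψ c σ N Φ k u q' z| +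
            collPair (fun _ => 1) c σ N Φ k q' u z * |relDefect Ψ c σ N Φ k q' u z|
        else 0)) =
      (cellCount c σ N * c)⁻¹ * ∑ e ∈ collTriples Φ (stepWindow c σ N k) z,
        (if cellMin (startCell c σ N Φ k z e.2.1) (startCell c σ N Φ k z e.2.2) = u then
            |relDefect Ψ c σ N Φ k (startCell c σ N Φ k z e.2.1) (startCell c σ N Φ k z e.2.2) z| else 0) := by
    rw [tsum_cell_eq_sum (B := cellBox (c * meanFreePath σ N)) (fun x hx => ?_)]
    · -- each bracket as a sum over the triples
      have hterm : ∀ x ∈ cellBox (c * meanFreePath σ N),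
          (if x = u then collPair (fun _ => 1) c σ N Φ k u u z * |relDefect Ψ c σ N Φ k u u z|
          else if u = cellMin u x then
            collPair (fun _ => 1) c σ N Φ k u x z * |relDefect Ψ c σ N Φ k u x z| +
              collPair (fun _ => 1) c σ N Φ k x u z * |relDefect Ψ c σ N Φ k x u z|
          else 0) = (cellCount c σ N * c)⁻¹ * ∑ e ∈ collTriples Φ (stepWindow c σ N k) z,
          (if x = u then (if startCell c σ N Φ k z e.2.1 = u ∧ startCell c σ N Φ k z e.2.2 = u then
            |relDefect Ψ c σ N Φ k (startCell c σ N Φ k z e.2.1) (startCell c σ N Φ k z e.2.2) z| else 0)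
            else if u = cellMin u x then
              ((if startCell c σ N Φ k z e.2.1 = u ∧ startCell c σ N Φ k z e.2.2 = x then
            |relDefect Ψ c σ N Φ k (startCell c σ N Φ k z e.2.1) (startCell c σ N Φ k z e.2.2) z| else 0) +
                (if startCell c σ N Φ k z e.2.1 = x ∧ startCell c σ N Φ k z e.2.2 = u then
            |relDefect Ψ c σ N Φ k (startCell c σ N Φ k z e.2.1) (startCell c σ N Φ k z e.2.2) z| else 0))
            else 0) := by
        intro x _
        rw [collPair_one_mul_eq Φ hz c k u u (fun a b => |relDefect Ψ c σ N Φ k a b z|),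
          collPair_one_mul_eq Φ hz c k u x (fun a b => |relDefect Ψ c σ N Φ k a b z|),
          collPair_one_mul_eq Φ hz c k x u (fun a b => |relDefect Ψ c σ N Φ k a b z|)]
        by_cases hxu : x = u
        · simp_rw [if_pos hxu]
        · by_cases hm : u = cellMin u x
          · simp_rw [if_neg hxu, if_pos hm]
            rw [Finset.sum_add_distrib, mul_add]
          · simp_rw [if_neg hxu, if_neg hm]
            rw [Finset.sum_const_zero, mul_zero]
      rw [Finset.sum_congr rfl hterm, ← Finset.mul_sum, Finset.sum_comm]
      congr 1
      refine Finset.sum_congr rfl fun e _ => ?_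
      exact sum_owner_indicator_eq (startCell_mem_cellBox hh Φ k z e.2.1) (startCell_mem_cellBox hh Φ k z e.2.2) u _
    · -- vanishing off the box
      by_cases hxu : x = u
      · subst hxu
        rw [if_pos rfl, collPair_eq_zero_of_not_mem hh _ Φ k (Or.inl hx) z, zero_mul]
      · rw [if_neg hxu, collPair_eq_zero_of_not_mem hh _ Φ k (Or.inr hx) z,
          collPair_eq_zero_of_not_mem hh _ Φ k (Or.inl hx) z, zero_mul, zero_mul, add_zero, ite_self]
  unfold unitDefect
  rw [hW]
  by_cases h0 : ownedCount c σ N Φ k u z = 0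
  · -- no owned triple: both sides vanish
    rw [h0, zero_mul]
    have hsum : ∑ e ∈ collTriples Φ (stepWindow c σ N k) z,
        (if cellMin (startCell c σ N Φ k z e.2.1) (startCell c σ N Φ k z e.2.2) = u then (1 : ℝ) else 0) = 0 := by
      have h := h0
      rw [ownedCount_eq_sum Φ hz] at h
      rcases mul_eq_zero.1 h with h' | h'
      · exact absurd h' (inv_ne_zero hpos.ne')
      · exact h'
    have hnone : ∀ e ∈ collTriples Φ (stepWindow c σ N k) z,
        ¬ cellMin (startCell c σ N Φ k z e.2.1) (startCell c σ N Φ k z e.2.2) = u := by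
      intro e he hu
      have hle := (Finset.sum_eq_zero_iff_of_nonneg fun e _ => by positivity).1 hsum e he
      rw [if_pos hu] at hle
      exact one_ne_zero hle
    symm
    rw [mul_eq_zero]
    exact Or.inr (Finset.sum_eq_zero fun e he => if_neg (hnone e he))
  · rw [← mul_assoc, mul_inv_cancel₀ h0, one_mul]

/-- **The cross-ratio defect of a step regrouped by owner**:
`Σ_q Σ_{q'} collPair 1 (q,q') |relDefect Ψ (q,q')| = Σ_u ownedCount u · unitDefect Ψ u` (box sums). [folklore] -/
theorem sum_collPair_mul_abs_relDefect_eq (hz : z ∈ Φ.good) (Ψ : V3 × V3 × V3 → ℝ) {c : ℝ} (hc : 0 < c) (hσ : 0 < σ)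
    (k : ℕ) :
    ∑ q ∈ cellBox (c * meanFreePath σ N), ∑ q' ∈ cellBox (c * meanFreePath σ N),
        collPair (fun _ => 1) c σ N Φ k q q' z * |relDefect Ψ c σ N Φ k q q' z| =
      ∑ u ∈ cellBox (c * meanFreePath σ N), ownedCount c σ N Φ k u z * unitDefect Ψ c σ N Φ k u z := by
  set B := cellBox (c * meanFreePath σ N) with hB
  set T := collTriples Φ (stepWindow c σ N k) z with hT
  set sc := startCell c σ N Φ k z with hsc
  have hh : 0 < c * meanFreePath σ N := mul_pos hc (meanFreePath_pos hσ N)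
  -- both sides equal `(n̄c)⁻¹ Σ_e |relDefect (start cells)|`
  have hR : ∑ u ∈ B, ownedCount c σ N Φ k u z * unitDefect Ψ c σ N Φ k u z =
      (cellCount c σ N * c)⁻¹ * ∑ e ∈ T, |relDefect Ψ c σ N Φ k (sc e.2.1) (sc e.2.2) z| := by
    simp_rw [ownedCount_mul_unitDefect_eq Φ hz Ψ hc hσ k]
    rw [← Finset.mul_sum, Finset.sum_comm]
    congr 1
    refine Finset.sum_congr rfl fun e _ => ?_
    rw [Finset.sum_ite_eq B (cellMin (sc e.2.1) (sc e.2.2)), if_pos]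
    rcases cellMin_mem_pair (sc e.2.1) (sc e.2.2) with h | h <;> rw [h]
    · exact startCell_mem_cellBox hh Φ k z e.2.1
    · exact startCell_mem_cellBox hh Φ k z e.2.2
  have hL : ∑ q ∈ B, ∑ q' ∈ B, collPair (fun _ => 1) c σ N Φ k q q' z * |relDefect Ψ c σ N Φ k q q' z| =
      (cellCount c σ N * c)⁻¹ * ∑ e ∈ T, |relDefect Ψ c σ N Φ k (sc e.2.1) (sc e.2.2) z| := by
    simp_rw [collPair_one_mul_eq Φ hz c k _ _ (fun a b => |relDefect Ψ c σ N Φ k a b z|)]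
    rw [Finset.sum_congr rfl fun q _ => (Finset.mul_sum _ _ _).symm, ← Finset.mul_sum]
    congr 1
    rw [Finset.sum_congr rfl fun q _ => Finset.sum_comm, Finset.sum_comm]
    refine Finset.sum_congr rfl fun e _ => ?_
    have hin : ∀ q ∈ B, ∑ q' ∈ B, (if sc e.2.1 = q ∧ sc e.2.2 = q' then |relDefect Ψ c σ N Φ k (sc e.2.1) (sc e.2.2) z|
        else 0) = if sc e.2.1 = q then |relDefect Ψ c σ N Φ k (sc e.2.1) (sc e.2.2) z| else 0 := by
      intro q _
      by_cases hq : sc e.2.1 = q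
      · simp only [hq, true_and, if_true]
        rw [Finset.sum_ite_eq B (sc e.2.2), if_pos (startCell_mem_cellBox hh Φ k z e.2.2)]
      · simp only [hq, false_and, if_false, Finset.sum_const_zero]
    rw [Finset.sum_congr rfl hin, Finset.sum_ite_eq B (sc e.2.1), if_pos (startCell_mem_cellBox hh Φ k z e.2.1)]
  rw [hL, hR]

/-- The owned triples of a unit pay at most `2CΨ` each: `ownedCount u · unitDefect Ψ u ≤ 2CΨ · ownedCount u`. [folklore] -/
theorem ownedCount_mul_unitDefect_le (hz : z ∈ Φ.good) {Ψ : V3 × V3 × V3 → ℝ} (hΨc : Continuous Ψ) {CΨ : ℝ}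
    (hΨ : ∀ p, |Ψ p| ≤ CΨ) {c : ℝ} (hc : 0 < c) (hσ : 0 < σ) (k : ℕ) (u : Cell) :
    ownedCount c σ N Φ k u z * unitDefect Ψ c σ N Φ k u z ≤ 2 * CΨ * ownedCount c σ N Φ k u z := by
  rw [ownedCount_mul_unitDefect_eq Φ hz Ψ hc hσ k u, ownedCount_eq_sum Φ hz]
  have h0 : 0 ≤ (cellCount c σ N * c)⁻¹ := inv_nonneg.2 (mul_pos (cellCount_pos hc hσ N) hc).le
  calc _ ≤ (cellCount c σ N * c)⁻¹ * ∑ e ∈ collTriples Φ (stepWindow c σ N k) z,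
        2 * CΨ * (if cellMin (startCell c σ N Φ k z e.2.1) (startCell c σ N Φ k z e.2.2) = u then (1 : ℝ) else 0) := by
        refine mul_le_mul_of_nonneg_left (Finset.sum_le_sum fun e _ => ?_) h0
        split_ifs
        · rw [mul_one]; exact abs_relDefect_le Φ hz hΨc hΨ hc hσ k _ _
        · rw [mul_zero]
    _ = _ := by rw [← Finset.mul_sum]; ring

/-- **Registered helper `sum_collPair_mul_abs_relDefect_le` (piece C of the docking S7): the cross-ratio defect of a step
against the line's increment.** For `η₁, T₁ ≥ 0`:
`Σ_q Σ_{q'} collPair 1 |relDefect Ψ| ≤ Σ_u [η₁ ownedCount u + 2CΨ (badWeight Ψ η₁ T₁ u + 2 rowCount u 𝟙{T₁/2 < rowCount u})]`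
(box sums; good units pay `η₁` per owned collision, bad units `2CΨ`, and the owned collisions of a bad unit beyond the
truncation are row collisions above level `T₁/2`, `ownedCount ≤ 2 rowCount`). [folklore] -/
theorem sum_collPair_mul_abs_relDefect_le : ∀ {σ : ℝ} {N : ℕ} (Φ : Flow σ N) {z : Phase N}, z ∈ Φ.good → ∀ {Ψ : V3 × V3 × V3 → ℝ}, Continuous Ψ → ∀ {CΨ : ℝ}, (∀ p, |Ψ p| ≤ CΨ) → ∀ {c : ℝ}, 0 < c → 0 < σ → σ < 2⁻¹ → ∀ (k : ℕ) {η₁ T₁ : ℝ}, 0 ≤ η₁ → 0 ≤ T₁ → ∑ q ∈ cellBox (c * meanFreePath σ N), ∑ q' ∈ cellBox (c * meanFreePath σ N), collPair (fun _ => 1) c σ N Φ k q q' z * |relDefect Ψ c σ N Φ k q q' z| ≤ ∑ q ∈ cellBox (c * meanFreePath σ N), (η₁ * ownedCount c σ N Φ k q z + 2 * CΨ * (badWeight Ψ η₁ T₁ c σ N Φ k q z + 2 * (rowCount c σ N Φ k q z * (if T₁ / 2 < rowCount c σ N Φ k q z then 1 else 0)))) := by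
  intro σ N Φ z hz Ψ hΨc CΨ hΨ c hc hσ hσ2 k η₁ T₁ hη₁ hT₁
  rw [sum_collPair_mul_abs_relDefect_eq Φ hz Ψ hc hσ k]
  refine Finset.sum_le_sum fun u _ => ?_
  have hCΨ : 0 ≤ CΨ := (abs_nonneg _).trans (hΨ 0)
  have hown := ownedCount_nonneg hc.le hσ Φ k u z; have hrow := rowCount_nonneg hc.le hσ Φ k u z
  have hbw := badWeight_nonneg hc.le hσ Ψ η₁ hT₁ Φ k u z
  have hind : 0 ≤ rowCount c σ N Φ k u z * (if T₁ / 2 < rowCount c σ N Φ k u z then 1 else 0) := by positivity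
  by_cases hgood : unitDefect Ψ c σ N Φ k u z ≤ η₁
  · -- good unit: `owned · unitDefect ≤ η₁ owned`
    calc ownedCount c σ N Φ k u z * unitDefect Ψ c σ N Φ k u z ≤ ownedCount c σ N Φ k u z * η₁ :=
          mul_le_mul_of_nonneg_left hgood hown
      _ = η₁ * ownedCount c σ N Φ k u z + 2 * CΨ * 0 := by ring
      _ ≤ _ := by gcongr; positivity
  · -- bad unit: `owned · unitDefect ≤ 2CΨ owned`, `owned ≤ badWeight + 2 row 𝟙{T₁/2 < row}`
    push Not at hgood
    have hbad : badWeight Ψ η₁ T₁ c σ N Φ k u z = min (ownedCount c σ N Φ k u z) T₁ := by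
      unfold badWeight; rw [if_pos hgood, mul_one]
    have hsplit : ownedCount c σ N Φ k u z ≤ badWeight Ψ η₁ T₁ c σ N Φ k u z +
        2 * (rowCount c σ N Φ k u z * (if T₁ / 2 < rowCount c σ N Φ k u z then 1 else 0)) := by
      rw [hbad]
      rcases le_or_gt (ownedCount c σ N Φ k u z) T₁ with hle | hlt
      · rw [min_eq_left hle]; linarith
      · have h2 := ownedCount_le_two_mul_rowCount Φ hz hc hσ hσ2 k u
        have hT : T₁ / 2 < rowCount c σ N Φ k u z := by linarith
        rw [min_eq_right hlt.le, if_pos hT, mul_one]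
        linarith
    calc ownedCount c σ N Φ k u z * unitDefect Ψ c σ N Φ k u z ≤ 2 * CΨ * ownedCount c σ N Φ k u z :=
          ownedCount_mul_unitDefect_le Φ hz hΨc hΨ hc hσ k u
      _ ≤ 2 * CΨ * (badWeight Ψ η₁ T₁ c σ N Φ k u z +
          2 * (rowCount c σ N Φ k u z * (if T₁ / 2 < rowCount c σ N Φ k u z then 1 else 0))) :=
          mul_le_mul_of_nonneg_left hsplit (by positivity)
      _ = 0 + _ := (zero_add _).symm
      _ ≤ _ := by gcongr; positivity

end Owner

end Summit.AtomisticToContinuum.HydrodynamicLimit.Theorems.EquilibriumForecastLine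

end
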